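import Mathlib
import HarnessLib
import Summits.CriticalPhenomena.CardyFormulaZ2.Theses.CardyMagicRigidity
import Summits.CriticalPhenomena.CardyFormulaZ2.Theorems.CardyMagicRigidityTransferContinuityReduction
import Summits.CriticalPhenomena.CardyFormulaZ2.Theorems.CardyMagicRigidityMagicFormulaTHexCells
import Summits.CriticalPhenomena.CardyFormulaZ2.Theorems.CardyMagicRigidityMagicFormulaTHexEdges
import Literature.Probability.Percolation.FullPlaneCNL
import Literature.Probability.Percolation.HexLatticeSegments
import Literature.Probability.Percolation.SiteInterfaceWinding
import Literature.Probability.Percolation.FKLoopNestingIntegrable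
import Literature.Probability.RandomPlanarGeometry.NestingTransform

/-!
# The Voronoi-cell bridge at mesh 1 (line `Sketch`, stub `stub_cellBridge`)

Crux `Summit.CriticalPhenomena.CardyFormulaZ2.Theses.CardyMagicRigidity.MagicFormulaT`
(stmt-CriticalPhenomena-4836), line `Sketch` (card `kac-window-vertex-operators`), stub
`stub_cellBridge` of the registered skeleton `Cruxes/MagicFormulaT/Lines/Sketch.lean`, proved
EXACTLY as registered (tree vocabulary only).  For an admissible density `f` (measurable, `|f| ≤ C`,
`f = 0` off `‖z‖ ≤ R`, `∫ f = 0`) and `0 < δ ≤ 1`, with `g = δ² f(δ ·)` (the dilated density on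
the unit lattice), the open Voronoi hexagons `H_x = {z | |hform i (z − x)| < 1 ∀ i}` of the sites
`x` of `𝕋` and the charge sites `S = triBall ⌈2(R/δ + 1)⌉₊`:

1. `Λ^𝕋_1(g) = E_{1/2}[∏_u 2cos(Σ_{x ∈ S} 𝟙[W(u, x) ≠ 0] ∫_{H_x} g + π/3)]` — the smeared transform
   IS the dense transform of the cell charges: configuration by configuration and loop by loop,
   `∫_{W(u,·) ≠ 0} g = Σ_{x ∈ S} 𝟙[W(u,x) ≠ 0] ∫_{H_x} g`, because the cells are disjoint, cover
   `ℂ` a.e., the cells of `S` carry all of `supp g ⊆ B̄(0, R/δ)`, and `W(u, ·)` is constant on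
   each cell (the cells are convex and miss every interface trace);
2. `|∫_{H_x} g| ≤ 4Cδ²` (`|g| ≤ δ²C`, `volume H_x ≤ π ≤ 4`);
3. `Σ_{x ∈ S} ∫_{H_x} g = ∫ g = ∫ f = 0`;
4. `‖x‖ ≤ (2|R| + 3)/δ` for `x ∈ S`.

Inputs: the cell geometry `…MagicFormulaTHexCells` (sub-goal `cellBridge_hexCellsTiling`), the
trace avoidance `…MagicFormulaTHexEdges` (sub-goal `cellBridge_tracesMissHexCells`),
`loops_siteLoopConfig` (`…TransferContinuityReduction`), local constancy of winding numbers off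
the trace (`UnbasedLoop.wind_eq_wind_of_dist_lt`, `FKLoopNestingIntegrable`),
`range_toCurve_eq_polyTrace`;
the abstract cell decomposition of set integrals (`setIntegral_setOf_ne_zero_eq_sum`, Mathlib's
`integral_biUnion_finset`) is proved here.  No named facts are used.
-/

noncomputable section

namespace Summit.CriticalPhenomena.CardyFormulaZ2.Cruxes.MagicFormulaT.LineSketch

open MeasureTheory Filter Finset
open scoped Real Topology BigOperators
open Literature.Probability.RandomPlanarGeometry Literature.Probability.Percolation
  Literature.Probability.LatticeModels

/-- The open Voronoi hexagon of the site `x` of the unit lattice (local notation, not a definition: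
the stub is stated with this set written inline). -/
local notation3 (prettyPrint := false) "𝓗[" x "]" =>
  {z : ℂ | ∀ i : Fin 3, |hform i (z - triMeshPoint 1 x)| < 1}

/-! ## Set integrals over finitely many disjoint cells (abstract) -/

section CellDecomposition

variable {α ι E : Type*} [MeasurableSpace α] {μ : Measure α} [NormedAddCommGroup E]
  [NormedSpace ℝ E]

/-- **Cell decomposition of a set integral**: if `g` is integrable and vanishes a.e. off the union
of finitely many pairwise disjoint measurable cells `H x`, `x ∈ S`, then for every measurable `A`,
`∫_A g = Σ_{x ∈ S} ∫_{H x ∩ A} g`. -/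
theorem setIntegral_eq_sum_setIntegral_inter (S : Finset ι) {H : ι → Set α}
    (hHm : ∀ x ∈ S, MeasurableSet (H x)) (hdisj : (S : Set ι).PairwiseDisjoint H)
    {g : α → E} (hg : Integrable g μ) (hcover : ∀ᵐ z ∂μ, z ∉ (⋃ x ∈ S, H x) → g z = 0)
    {A : Set α} (hA : MeasurableSet A) :
    ∫ z in A, g z ∂μ = ∑ x ∈ S, ∫ z in H x ∩ A, g z ∂μ := by
  have hU : MeasurableSet (⋃ x ∈ S, H x) := Finset.measurableSet_biUnion S hHm
  have hae : g =ᵐ[μ] (⋃ x ∈ S, H x).indicator g := by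
    filter_upwards [hcover] with z hz
    by_cases h : z ∈ ⋃ x ∈ S, H x
    · rw [Set.indicator_of_mem h]
    · rw [Set.indicator_of_notMem h, hz h]
  calc ∫ z in A, g z ∂μ = ∫ z in A, (⋃ x ∈ S, H x).indicator g z ∂μ :=
        integral_congr_ae (ae_restrict_of_ae hae)
    _ = ∫ z in (⋃ x ∈ S, H x) ∩ A, g z ∂μ := by
        rw [integral_indicator hU, Measure.restrict_restrict hU]
    _ = ∫ z in ⋃ x ∈ S, (H x ∩ A), g z ∂μ := by rw [Set.iUnion₂_inter]
    _ = ∑ x ∈ S, ∫ z in H x ∩ A, g z ∂μ :=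
        integral_biUnion_finset S (fun x hx ↦ (hHm x hx).inter hA)
          (hdisj.mono fun x ↦ (Set.inter_subset_left : H x ∩ A ⊆ H x)) (fun x _ ↦ hg.integrableOn)

/-- **Cell decomposition of the integral**: `∫ g = Σ_{x ∈ S} ∫_{H x} g` under the hypotheses of
`setIntegral_eq_sum_setIntegral_inter`. -/
theorem integral_eq_sum_setIntegral (S : Finset ι) {H : ι → Set α}
    (hHm : ∀ x ∈ S, MeasurableSet (H x)) (hdisj : (S : Set ι).PairwiseDisjoint H)
    {g : α → E} (hg : Integrable g μ) (hcover : ∀ᵐ z ∂μ, z ∉ (⋃ x ∈ S, H x) → g z = 0) :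
    ∫ z, g z ∂μ = ∑ x ∈ S, ∫ z in H x, g z ∂μ := by
  have h := setIntegral_eq_sum_setIntegral_inter S hHm hdisj hg hcover MeasurableSet.univ
  simp only [Measure.restrict_univ, Set.inter_univ] at h
  exact h

/-- **Cell decomposition with a cellwise constant weight**: if moreover the integer weight `w` is
constant on each cell, `w = w (c x)` on `H x`, and `{w ≠ 0}` is measurable, then
`∫_{w ≠ 0} g = Σ_{x ∈ S} 𝟙[w (c x) ≠ 0] · ∫_{H x} g`. -/
theorem setIntegral_setOf_ne_zero_eq_sum (S : Finset ι) {H : ι → Set α}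
    (hHm : ∀ x ∈ S, MeasurableSet (H x)) (hdisj : (S : Set ι).PairwiseDisjoint H)
    {g : α → E} (hg : Integrable g μ) (hcover : ∀ᵐ z ∂μ, z ∉ (⋃ x ∈ S, H x) → g z = 0)
    {w : α → ℤ} (hw : MeasurableSet {z | w z ≠ 0}) (c : ι → α)
    (hc : ∀ x ∈ S, ∀ z ∈ H x, w z = w (c x)) :
    ∫ z in {z | w z ≠ 0}, g z ∂μ = ∑ x ∈ S, if w (c x) ≠ 0 then ∫ z in H x, g z ∂μ else 0 := by
  rw [setIntegral_eq_sum_setIntegral_inter S hHm hdisj hg hcover hw]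
  refine Finset.sum_congr rfl fun x hx ↦ ?_
  split_ifs with h
  · rw [Set.inter_eq_left.2 fun z hz ↦ ?_]
    rw [Set.mem_setOf_eq, hc x hx z hz]
    exact h
  · have hd : Disjoint (H x) {z | w z ≠ 0} :=
      Set.disjoint_left.2 fun z hz hz' ↦ hz' (by rw [hc x hx z hz]; exact not_not.1 h)
    rw [hd.inter_eq, Measure.restrict_empty, integral_zero_measure]

end CellDecomposition

/-! ## The cells have measure at most `π ≤ 4` -/

/-- The cell has Lebesgue measure at most `π` (that of the unit disc). -/
theorem volume_hexCell_le (x : Site 2) : volume 𝓗[x] ≤ ENNReal.ofReal π := by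
  refine (measure_mono (hexCell_subset_ball x)).trans ?_
  rw [Complex.volume_ball, ENNReal.ofReal_one, one_pow, one_mul, ← NNReal.coe_real_pi,
    ENNReal.ofReal_coe_nnreal]

/-- The cell has finite Lebesgue measure. -/
theorem volume_hexCell_lt_top (x : Site 2) : volume 𝓗[x] < ⊤ :=
  (volume_hexCell_le x).trans_lt ENNReal.ofReal_lt_top

/-- The cell has real Lebesgue measure at most `4`. -/
theorem volume_real_hexCell_le_four (x : Site 2) : volume.real 𝓗[x] ≤ 4 := by
  have h : volume.real 𝓗[x] ≤ π := by
    rw [measureReal_def, ← ENNReal.toReal_ofReal Real.pi_pos.le]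
    exact ENNReal.toReal_mono ENNReal.ofReal_ne_top (volume_hexCell_le x)
  exact h.trans Real.pi_le_four

/-! ## Winding numbers of interface loops are constant on the cells -/

/-- The trace of the drawn interface loop at mesh `1` is the polygon trace `polyTrace 1 γ`. -/
theorem range_mk_siteLoopCurve_one {v : HexVertex} (γ : hexGraph.Walk v v) (hlen : 0 < γ.length) :
    (UnbasedLoop.mk (BasedLoop.mk (siteLoopCurve 1 γ) (isLoop_siteLoopCurve 1 γ))).range =
      polyTrace 1 γ := by
  rw [UnbasedLoop.range_mk, BasedLoop.toCurveClass_mk, siteLoopCurve, CurveClass.range_mk]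
  exact range_toCurve_eq_polyTrace hlen

/-- **The winding number of an unbased loop is constant on a preconnected set missing its trace**
(it is locally constant off the trace, `UnbasedLoop.wind_eq_wind_of_dist_lt`). -/
theorem unbasedLoop_wind_eq_of_isPreconnected (u : UnbasedLoop ℂ) {T : Set ℂ}
    (hT : IsPreconnected T) (hdisj : Disjoint T u.range) {z w : ℂ} (hz : z ∈ T) (hw : w ∈ T) :
    u.wind z = u.wind w := by
  refine hT.constant (fun y hy ↦ ?_) hz hw
  have hyr : y ∉ u.range := Set.disjoint_left.1 hdisj hy
  have hpos : 0 < Metric.infDist y u.range :=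
    (u.isCompact_range.isClosed.notMem_iff_infDist_pos u.range_nonempty).1 hyr
  have hca : ContinuousAt (fun _ : ℂ ↦ u.wind y) y := continuousAt_const
  refine (hca.congr ?_).continuousWithinAt
  filter_upwards [Metric.ball_mem_nhds y hpos] with x hx
  exact (u.wind_eq_wind_of_dist_lt (Metric.mem_ball.1 hx)).symm

/-- **The winding number of an interface loop of the unit lattice is constant on every open cell**,
equal to its value at the cell's site: the cell is convex and misses the trace. -/
theorem wind_eq_wind_triMeshPoint_of_mem_hexCell {cfg : SiteConfig (Site 2)} {v : HexVertex}
    {γ : hexGraph.Walk v v} (hγ : IsSiteInterfaceLoop cfg γ) (x : Site 2) {z : ℂ} (hz : z ∈ 𝓗[x]) :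
    (UnbasedLoop.mk (BasedLoop.mk (siteLoopCurve 1 γ) (isLoop_siteLoopCurve 1 γ))).wind z =
      (UnbasedLoop.mk (BasedLoop.mk (siteLoopCurve 1 γ) (isLoop_siteLoopCurve 1 γ))).wind
        (triMeshPoint 1 x) := by
  have hlen : 0 < γ.length := by have := hγ.1.three_le_length; omega
  refine unbasedLoop_wind_eq_of_isPreconnected _ (isPreconnected_hexCell x) ?_ hz
    (triMeshPoint_mem_hexCell x)
  rw [range_mk_siteLoopCurve_one γ hlen]
  exact cellBridge_tracesMissHexCells cfg v γ hγ x

/-! ## The dilated density `g = δ² f(δ ·)` -/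

section Density

variable {f : ℂ → ℝ} {R C δ : ℝ}

/-- Off `B̄(0, R/δ)` the dilated density vanishes. -/
theorem norm_le_of_dilate_ne_zero (hR : ∀ z, R < ‖z‖ → f z = 0) (hδ : 0 < δ) {z : ℂ}
    (hz : δ ^ 2 * f ((δ : ℂ) * z) ≠ 0) : ‖z‖ ≤ R / δ := by
  by_contra h
  rw [not_le, div_lt_iff₀ hδ] at h
  have : R < ‖(δ : ℂ) * z‖ := by
    rw [norm_mul, Complex.norm_real, Real.norm_eq_abs, abs_of_pos hδ, mul_comm]
    exact h
  exact hz (by rw [hR _ this, mul_zero])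

/-- The dilated density is bounded by `δ²C`. -/
theorem norm_dilate_le (hC : ∀ z, |f z| ≤ C) (δ : ℝ) (z : ℂ) :
    ‖δ ^ 2 * f ((δ : ℂ) * z)‖ ≤ δ ^ 2 * C := by
  rw [Real.norm_eq_abs, abs_mul, abs_pow, sq_abs]
  exact mul_le_mul_of_nonneg_left (hC _) (sq_nonneg δ)

/-- **The dilated density is integrable** (bounded, measurable, supported in `B̄(0, R/δ)`). -/
theorem integrable_dilate (hf : Measurable f) (hC : ∀ z, |f z| ≤ C)
    (hR : ∀ z, R < ‖z‖ → f z = 0) (hδ : 0 < δ) :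
    Integrable (fun z : ℂ ↦ δ ^ 2 * f ((δ : ℂ) * z)) := by
  have hmeas : AEStronglyMeasurable (fun z : ℂ ↦ δ ^ 2 * f ((δ : ℂ) * z)) volume :=
    ((hf.comp (measurable_const.mul measurable_id)).const_mul _).aestronglyMeasurable
  refine IntegrableOn.integrable_of_forall_notMem_eq_zero
    (s := Metric.closedBall (0 : ℂ) (R / δ)) ?_ fun z hz ↦ ?_
  · refine Measure.integrableOn_of_bounded (M := δ ^ 2 * C) measure_closedBall_lt_top.ne hmeas ?_
    exact ae_of_all _ fun z ↦ norm_dilate_le hC δ z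
  · by_contra hne
    exact hz (Metric.mem_closedBall.2 (by simpa using norm_le_of_dilate_ne_zero hR hδ hne))

/-- **The cells of the charge sites carry the dilated density**: a.e., `g` vanishes off
`⋃_{x ∈ triBall ⌈2(R/δ+1)⌉₊} H_x` (a.e. point lies in some cell, and a cell meeting
`supp g ⊆ B̄(0, R/δ)` has its site in the charge set). -/
theorem ae_dilate_eq_zero_off_cells (hR : ∀ z, R < ‖z‖ → f z = 0) (hδ : 0 < δ) :
    ∀ᵐ z ∂(volume : Measure ℂ), z ∉ (⋃ x ∈ triBall ⌈2 * (R / δ + 1)⌉₊, 𝓗[x]) →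
      δ ^ 2 * f ((δ : ℂ) * z) = 0 := by
  filter_upwards [ae_exists_mem_hexCell] with z hz hzU
  obtain ⟨a, ha⟩ := hz
  by_contra hne
  have hzR := norm_le_of_dilate_ne_zero hR hδ hne
  exact hzU (Set.mem_iUnion₂.2 ⟨a, mem_triBall_of_mem_hexCell_of_norm_le ha hzR, ha⟩)

/-- **`∫ g = 0`**: `∫ δ² f(δ z) dz = δ² · δ⁻² ∫ f = ∫ f = 0` (`Measure.integral_comp_smul`). -/
theorem integral_dilate_eq_zero (h0 : ∫ z, f z = 0) (δ : ℝ) :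
    ∫ z : ℂ, δ ^ 2 * f ((δ : ℂ) * z) = 0 := by
  rw [integral_const_mul]
  have h : ∫ z : ℂ, f ((δ : ℂ) * z) = 0 := by
    have h1 := Measure.integral_comp_smul volume f δ
    simp only [Complex.real_smul] at h1
    rw [h1, h0, smul_zero]
  rw [h, mul_zero]

/-- **Cell charges are small**: `|∫_{H_x} g| ≤ 4Cδ²` (`|g| ≤ δ²C`, `volume H_x ≤ π ≤ 4`). -/
theorem abs_setIntegral_hexCell_dilate_le (hC : ∀ z, |f z| ≤ C) (δ : ℝ) (x : Site 2) :
    |∫ z in 𝓗[x], δ ^ 2 * f ((δ : ℂ) * z)| ≤ 4 * C * δ ^ 2 := by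
  have hC0 : 0 ≤ C := (abs_nonneg _).trans (hC 0)
  have h1 := norm_setIntegral_le_of_norm_le_const (volume_hexCell_lt_top x)
    (fun z _ ↦ norm_dilate_le hC δ z)
  rw [Real.norm_eq_abs] at h1
  calc |∫ z in 𝓗[x], δ ^ 2 * f ((δ : ℂ) * z)| ≤ δ ^ 2 * C * volume.real 𝓗[x] := h1
    _ ≤ δ ^ 2 * C * 4 :=
        mul_le_mul_of_nonneg_left (volume_real_hexCell_le_four x) (by positivity)
    _ = 4 * C * δ ^ 2 := by ring

end Density

/-! ## The stub -/

/-- **Stub `stub_cellBridge` of line `Sketch` (crux `MagicFormulaT`): the exact Voronoi-cell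
bridge at mesh `1`.**  For admissible `f` and `0 < δ ≤ 1`: (i) `Λ^𝕋_1(f_δ)` IS the dense
transform of the cell charges `λ_x = ∫_{H_x} f_δ` on `triBall ⌈2(R/δ + 1)⌉₊` (winding numbers of
interface loops are constant on the open cells, which miss every trace and cover `ℂ` a.e.; the
cells of the charge sites carry `supp f_δ`); (ii) `|λ_x| ≤ 4Cδ²`; (iii) `Σ_x λ_x = ∫ f_δ = ∫ f = 0`;
(iv) the charge sites have norm `≤ (2|R| + 3)/δ`. -/
theorem stub_cellBridge : ∀ (f : ℂ → ℝ) (R C δ : ℝ), Measurable f → (∀ z, |f z| ≤ C) →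
    (∀ z, R < ‖z‖ → f z = 0) → ∫ z, f z = 0 → 0 < δ → δ ≤ 1 →
    ((∫ cfg, (∏ᶠ u ∈ {u : UnbasedLoop ℂ | ∃ (v : HexVertex) (γ : hexGraph.Walk v v),
          IsSiteInterfaceLoop cfg γ ∧
            u = UnbasedLoop.mk (BasedLoop.mk (siteLoopCurve 1 γ) (isLoop_siteLoopCurve 1 γ))},
          2 * Real.cos ((∫ z in {z : ℂ | u.wind z ≠ 0}, δ ^ 2 * f ((δ : ℂ) * z)) + Real.pi / 3))
            ∂(triSitePercolation half)) =
        ∫ cfg, (∏ᶠ u ∈ (siteLoopConfig 1 cfg).loops,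
          2 * Real.cos ((∑ x ∈ triBall ⌈2 * (R / δ + 1)⌉₊,
            if u.wind (triMeshPoint 1 x) ≠ 0 then
              (∫ z in {z : ℂ | ∀ i : Fin 3, |hform i (z - triMeshPoint 1 x)| < 1}, δ ^ 2 * f ((δ : ℂ) * z))
            else 0) + π / 3)) ∂(triSitePercolation half)) ∧
      (∀ x ∈ triBall ⌈2 * (R / δ + 1)⌉₊,
        |∫ z in {z : ℂ | ∀ i : Fin 3, |hform i (z - triMeshPoint 1 x)| < 1}, δ ^ 2 * f ((δ : ℂ) * z)|
          ≤ 4 * C * δ ^ 2) ∧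
      (∑ x ∈ triBall ⌈2 * (R / δ + 1)⌉₊,
        ∫ z in {z : ℂ | ∀ i : Fin 3, |hform i (z - triMeshPoint 1 x)| < 1}, δ ^ 2 * f ((δ : ℂ) * z)) = 0 ∧
      (∀ x ∈ triBall ⌈2 * (R / δ + 1)⌉₊, ‖triMeshPoint 1 x‖ ≤ (2 * |R| + 3) / δ) := by
  intro f R C δ hf hC hR h0 hδ hδ1
  have hg := integrable_dilate hf hC hR hδ
  have hcover := ae_dilate_eq_zero_off_cells (f := f) hR hδ
  have hHm : ∀ x ∈ triBall ⌈2 * (R / δ + 1)⌉₊, MeasurableSet 𝓗[x] := fun x _ ↦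
    measurableSet_hexCell x
  have hdisj : ((triBall ⌈2 * (R / δ + 1)⌉₊ : Finset (Site 2)) : Set (Site 2)).PairwiseDisjoint
      (fun x : Site 2 ↦ 𝓗[x]) := fun x _ y _ hxy ↦ disjoint_hexCell hxy
  refine ⟨?_, fun x _ ↦ abs_setIntegral_hexCell_dilate_le hC δ x, ?_,
    fun x hx ↦ norm_triMeshPoint_le_of_mem_triBall hδ hδ1 hx⟩
  · -- (i) the bridge identity, configuration by configuration and loop by loop
    refine integral_congr_ae (Eventually.of_forall fun cfg ↦ ?_)
    dsimp only
    rw [Summit.CriticalPhenomena.CardyFormulaZ2.Theorems.loops_siteLoopConfig]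
    refine finprod_mem_congr rfl fun u hu ↦ ?_
    obtain ⟨v, γ, hγ, rfl⟩ := hu
    rw [setIntegral_setOf_ne_zero_eq_sum (triBall ⌈2 * (R / δ + 1)⌉₊) hHm hdisj hg hcover
      (UnbasedLoop.isOpen_setOf_wind_ne_zero _).measurableSet (fun x ↦ triMeshPoint 1 x)
      (fun x _ z hz ↦ wind_eq_wind_triMeshPoint_of_mem_hexCell hγ x hz)]
  · -- (iii) neutrality of the cell charges
    rw [← integral_eq_sum_setIntegral (triBall ⌈2 * (R / δ + 1)⌉₊) hHm hdisj hg hcover]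
    exact integral_dilate_eq_zero h0 δ

end Summit.CriticalPhenomena.CardyFormulaZ2.Cruxes.MagicFormulaT.LineSketch

end
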